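import Mathlib
import HarnessLib
import Summits.HubbardSuperconductivity.HubbardSuperconductivity.Theorems.KLProgrammeKLRegimeVolumeLimitTorusPeriodisation
import Literature.MathematicalPhysics.QuantumLattice.HubbardGridFieldSubstitution
import Literature.MathematicalPhysics.QuantumLattice.HubbardShiftedCovarianceDecomposition

/-!
# β′ model step (m2): the grid-pulled-back normal covariance with a SAMPLED symbol periodises EXACTLY between nested tori
# (cell gate-hubbard-kl, seat hubbard-kl-k3c4-p1 g6, technique «FST2 volume lemmas»; k3c5-p2's BETA-PRIME-ROADMAP (m2); `--supports` the VL item)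

For `Lf = b·L` and a symbol family `p_L((ω,q),σ) = (β L²)·F ω σ (p_q)` (the programme's normalisation: `shiftedFreeSymbol`, every slice symbol, the frame
symbol — all are `(βL²)` × a function of the Matsubara frequency and of the LATTICE MOMENTUM `p_q`), the `(+,−)` position–time propagator of the grid
pull-back `Sᵀ (normalCovariance p) S` (`gridSub_pullback_normalCovariance_apply_zero_one`) satisfies, per Matsubara frequency and hence summed:

  `Σ_{red x′ = x̄′} (Sᵀ C_{Lf} S)((x,τ,σ,+),(x′,τ′,σ,−)) = (Sᵀ C_L S)((red x,τ,σ,+),(x̄′,τ′,σ,−))`      (`gridPropagator_periodise`)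

i.e. the coarse-torus propagator IS the periodisation of the fine one (no error) — so the defect covariance `D = C_{bL} − C^{dec}` of β′ has SAME-BLOCK entries
equal to minus the windings (`coarse_loop…`, `le_tnorm_of_reduce_eq_zero` of `…TorusPeriodisation`).  Ingredients: `exp_vertexPhase_sub` (time/space split),
the character bridge `exp(i Σ_j p_q,j (x_j.val − x′_j.val)) = χ_q(x − x′)` (§1), fibre reflection, and `periodise_torusFourierInv_sampled` (§2 of
`…TorusPeriodisation`).  Everything is proved; no definition; nothing is asserted about the model.
-/

noncomputable section

namespace Summit.HubbardSuperconductivity.HubbardSuperconductivity.Theorems.TwoPointAssembly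

set_option linter.dupNamespace false

open Finset Complex Literature.MathematicalPhysics.QuantumLattice Literature.Probability.LatticeModels
open scoped ComplexConjugate

/-! ## §1 The spatial phase of the grid fields is a torus character -/

section Char

variable {L : ℕ} [NeZero L]

/-- `exp(i Σ_j p_q,j · x_j.val) = χ_q(x)` (the lattice-momentum phase at the representatives `x_j.val`). [folklore] -/
theorem exp_sum_latticeMomentum_mul_val (q x : TorusSite 2 L) :
    Complex.exp (((∑ j, latticeMomentum L q j * ((x j).val : ℝ) : ℝ) : ℂ) * Complex.I) = torusChar q x := by
  unfold torusChar
  simp_rw [stdAddChar_mul_eq_exp]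
  rw [← Complex.exp_sum]
  congr 1
  push_cast
  rw [Finset.sum_mul]
  refine Finset.sum_congr rfl fun j _ => ?_
  simp only [latticeMomentum]
  have hL : (L : ℂ) ≠ 0 := by exact_mod_cast NeZero.ne L
  push_cast
  field_simp

/-- **The `(+,−)` spatial phase difference is the character of the difference**:
`exp(i Σ_j p_q,j (x_j.val − x′_j.val)) = χ_q(x − x′)`. [folklore] -/
theorem exp_sum_latticeMomentum_mul_val_sub (q x x' : TorusSite 2 L) :
    Complex.exp (((∑ j, latticeMomentum L q j * (((x j).val : ℝ) - ((x' j).val : ℝ)) : ℝ) : ℂ) * Complex.I) = torusChar q (x - x') := by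
  rw [torusChar_sub_right, ← exp_sum_latticeMomentum_mul_val q x, ← exp_sum_latticeMomentum_mul_val q x', ← Complex.exp_conj,
    ← Complex.exp_add]
  congr 1
  simp only [map_mul, Complex.conj_ofReal, Complex.conj_I]
  push_cast
  simp only [mul_sub, Finset.sum_sub_distrib]
  ring

end Char


/-! ## §2 Fibre reflection and the spatial propagator per Matsubara frequency -/

section Nested

variable {d b m M : ℕ} [NeZero M] [NeZero m]

omit [NeZero m] in
/-- **Fibre reflection**: `Σ_{red x′ = a} G (x − x′) = Σ_{red w = red x − a} G w`. [folklore] -/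
theorem sum_fibre_sub_left (hM : M = b * m) (G : TorusSite d M → ℂ) (x : TorusSite d M) (a : TorusSite d m) :
    ∑ x' ∈ univ.filter (fun x' : TorusSite d M => (fun i => (((x' i).val : ℕ) : ZMod m)) = a), G (x - x') =
      ∑ w ∈ univ.filter (fun w : TorusSite d M =>
        (fun i => (((w i).val : ℕ) : ZMod m)) = (fun i => (((x i).val : ℕ) : ZMod m)) - a), G w := by
  classical
  refine Finset.sum_bij' (fun x' _ => x - x') (fun w _ => x - w) ?_ ?_ ?_ ?_ ?_
  · intro x' hx'
    simp only [mem_filter, mem_univ, true_and] at hx' ⊢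
    rw [reduce_sub hM, hx']
  · intro w hw
    simp only [mem_filter, mem_univ, true_and] at hw ⊢
    rw [reduce_sub hM, hw, sub_sub_cancel]
  · intro x' _; simp
  · intro w _; simp
  · intro x' _; rfl

end Nested

section Spatial

variable {b L Lf : ℕ} [NeZero Lf] [NeZero L]

/-- **The spatial propagator of ONE Matsubara frequency periodises exactly**: for `Lf = b·L` and any symbol slice `f`,
`Σ_{red x′ = x̄′} Lf⁻² Σ_q f(p_q) χ_q(x − x′) = L⁻² Σ_{q′} f(p_{q′}) χ_{q′}(red x − x̄′)`. [folklore] -/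
theorem periodise_spatialPropagator (hLf : Lf = b * L) (f : (Fin 2 → ℝ) → ℂ) (x : TorusSite 2 Lf) (xbar' : TorusSite 2 L) :
    ∑ x' ∈ univ.filter (fun x' : TorusSite 2 Lf => (fun i => (((x' i).val : ℕ) : ZMod L)) = xbar'),
        ((Lf : ℂ) ^ 2)⁻¹ * ∑ q : TorusSite 2 Lf, f (latticeMomentum Lf q) * torusChar q (x - x') =
      ((L : ℂ) ^ 2)⁻¹ * ∑ q : TorusSite 2 L, f (latticeMomentum L q) * torusChar q ((fun i => (((x i).val : ℕ) : ZMod L)) - xbar') := by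
  have hfine : ∀ y : TorusSite 2 Lf, ((Lf : ℂ) ^ 2)⁻¹ * ∑ q : TorusSite 2 Lf, f (latticeMomentum Lf q) * torusChar q y =
      torusFourierInv (fun q : TorusSite 2 Lf => f (latticeMomentum Lf q)) y := fun y => by
    rw [torusFourierInv_eq_sum_torusChar]
  have hcoarse : ∀ y : TorusSite 2 L, ((L : ℂ) ^ 2)⁻¹ * ∑ q : TorusSite 2 L, f (latticeMomentum L q) * torusChar q y =
      torusFourierInv (fun q : TorusSite 2 L => f (latticeMomentum L q)) y := fun y => by
    rw [torusFourierInv_eq_sum_torusChar]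
  simp_rw [hfine, hcoarse]
  rw [sum_fibre_sub_left hLf (torusFourierInv (fun q : TorusSite 2 Lf => f (latticeMomentum Lf q))) x xbar',
    periodise_torusFourierInv_sampled hLf f]

end Spatial


/-! ## §3 The grid-pulled-back normal covariance with a sampled symbol periodises exactly -/

section Grid

variable {b L Lf M : ℕ} [NeZero Lf] [NeZero L]

/-- One Matsubara frequency, one volume: the `(+,−)` summand of `gridSub_pullback_normalCovariance_apply_zero_one` with a symbol
`(βV²)·F(p_q)` collapses to `(E/β) · (V⁻² Σ_q F(p_q) χ_q(z))` (`E` = the time phase). [folklore] -/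
theorem sum_gridSummand_eq {V : ℕ} [NeZero V] {β : ℝ} (hβ : β ≠ 0) (E : ℂ) (f : (Fin 2 → ℝ) → ℂ) (z : TorusSite 2 V) :
    ∑ q : TorusSite 2 V, ((1 / (β * (V : ℝ) ^ 2) : ℝ) : ℂ) ^ 2 * (E * torusChar q z * (((β * (V : ℝ) ^ 2 : ℝ) : ℂ) * f (latticeMomentum V q))) =
      (E / (β : ℂ)) * (((V : ℂ) ^ 2)⁻¹ * ∑ q : TorusSite 2 V, f (latticeMomentum V q) * torusChar q z) := by
  rw [Finset.mul_sum, Finset.mul_sum]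
  refine Finset.sum_congr rfl fun q _ => ?_
  have hV : (V : ℂ) ≠ 0 := by exact_mod_cast NeZero.ne V
  have hβ' : (β : ℂ) ≠ 0 := by exact_mod_cast hβ
  push_cast
  field_simp

/-- **β′ (m2): the position–time propagator of the grid pull-back periodises EXACTLY between nested tori.**  For `Lf = b·L`, `β ≠ 0`, and symbols
`p_V((ω,q),σ) = (βV²)·F ω σ (p_q)` at `V = L, Lf` (same `F`), the `(+,−)` summand-sums of `gridSub_pullback_normalCovariance_apply_zero_one` satisfy
`Σ_{red x′ = x̄′} [fine, at (x,τ),(x′,τ′)] = [coarse, at (red x, τ),(x̄′,τ′)]`. [folklore] -/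
theorem gridPropagator_sum_periodise (hLf : Lf = b * L) {β : ℝ} (hβ : β ≠ 0) (F : MatsubaraIdx M → Fin 2 → (Fin 2 → ℝ) → ℂ)
    (pL : FreqMomentum L M × Fin 2 → ℂ) (pLf : FreqMomentum Lf M × Fin 2 → ℂ)
    (hpL : ∀ (k : FreqMomentum L M) (σ : Fin 2), pL (k, σ) = ((β * (L : ℝ) ^ 2 : ℝ) : ℂ) * F k.1 σ (latticeMomentum L k.2))
    (hpLf : ∀ (k : FreqMomentum Lf M) (σ : Fin 2), pLf (k, σ) = ((β * (Lf : ℝ) ^ 2 : ℝ) : ℂ) * F k.1 σ (latticeMomentum Lf k.2))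
    (x : TorusSite 2 Lf) (xbar' : TorusSite 2 L) (τ τ' : ℝ) (σ : Fin 2) :
    ∑ x' ∈ univ.filter (fun x' : TorusSite 2 Lf => (fun i => (((x' i).val : ℕ) : ZMod L)) = xbar'),
        ∑ k : FreqMomentum Lf M, ((1 / (β * (Lf : ℝ) ^ 2) : ℝ) : ℂ) ^ 2 *
          (Complex.exp (((vertexPhase Lf M β k x τ - vertexPhase Lf M β k x' τ' : ℝ) : ℂ) * Complex.I) * pLf (k, σ)) =
      ∑ k : FreqMomentum L M, ((1 / (β * (L : ℝ) ^ 2) : ℝ) : ℂ) ^ 2 *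
        (Complex.exp (((vertexPhase L M β k (fun i => (((x i).val : ℕ) : ZMod L)) τ - vertexPhase L M β k xbar' τ' : ℝ) : ℂ) * Complex.I) *
          pL (k, σ)) := by
  -- split the phases into time and space, turn the space phase into a character, insert the symbols
  simp_rw [exp_vertexPhase_sub, exp_sum_latticeMomentum_mul_val_sub, hpL, hpLf]
  -- sum over `k = (ω, q)` as `Σ_ω Σ_q`, collapse the `q`-sums
  simp_rw [Fintype.sum_prod_type, sum_gridSummand_eq hβ]
  -- fine side: commute `Σ_{x'}` with `Σ_ω` and the scalar, then periodise the spatial propagator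
  rw [Finset.sum_comm]
  refine Finset.sum_congr rfl fun ω _ => ?_
  rw [← Finset.mul_sum, periodise_spatialPropagator hLf (F ω σ) x xbar']

/-- **β′ (m2), matrix form**: for `Lf = b·L`, the `(+,−)` entries of the grid pull-backs `Sᵀ (normalCovariance p_V) S` (`S = hubbardGridSub V M β N`,
same time grid `N`, same Matsubara cutoff `M`) with symbols `p_V = (βV²)·F` satisfy
`Σ_{red x′ = x̄′} (Sᵀ C_{Lf} S)(((j,x),σ),+)(((j′,x′),σ),−) = (Sᵀ C_L S)(((j, red x),σ),+)(((j′,x̄′),σ),−)` — the coarse propagator is the periodised fine one. [folklore] -/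
theorem hubbardGridSub_pullback_zero_one_periodise (hLf : Lf = b * L) {β : ℝ} (hβ : β ≠ 0) (N : ℕ)
    (F : MatsubaraIdx M → Fin 2 → (Fin 2 → ℝ) → ℂ) (pL : FreqMomentum L M × Fin 2 → ℂ) (pLf : FreqMomentum Lf M × Fin 2 → ℂ)
    (hpL : ∀ (k : FreqMomentum L M) (σ : Fin 2), pL (k, σ) = ((β * (L : ℝ) ^ 2 : ℝ) : ℂ) * F k.1 σ (latticeMomentum L k.2))
    (hpLf : ∀ (k : FreqMomentum Lf M) (σ : Fin 2), pLf (k, σ) = ((β * (Lf : ℝ) ^ 2 : ℝ) : ℂ) * F k.1 σ (latticeMomentum Lf k.2))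
    (j j' : Fin N) (x : TorusSite 2 Lf) (xbar' : TorusSite 2 L) (σ : Fin 2) :
    ∑ x' ∈ univ.filter (fun x' : TorusSite 2 Lf => (fun i => (((x' i).val : ℕ) : ZMod L)) = xbar'),
        ((hubbardGridSub Lf M β N).transpose * normalCovariance Lf M pLf * hubbardGridSub Lf M β N) (((j, x), σ), 0) (((j', x'), σ), 1) =
      ((hubbardGridSub L M β N).transpose * normalCovariance L M pL * hubbardGridSub L M β N)
        (((j, (fun i => (((x i).val : ℕ) : ZMod L))), σ), 0) (((j', xbar'), σ), 1) := by
  simp only [hubbardGridSub, gridSub_pullback_normalCovariance_apply_zero_one, if_true]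
  exact gridPropagator_sum_periodise hLf hβ F pL pLf hpL hpLf x xbar' (gridTime β N j) (gridTime β N j') σ

end Grid

/-! ## §4 The programme's symbols are of the sampled form `(βV²)·F ω σ (p_q)` -/

section Symbols

variable {V M : ℕ}

/-- **The Matsubara-shifted free symbol is `(βV²)` × a function of the frequency and of the LATTICE MOMENTUM** (`ξ = ε(p) − μ`,
`ε(p) = −2 Σ_i cos p_i`): the hypothesis `hpL`/`hpLf` of `gridPropagator_sum_periodise` for `shiftedFreeSymbol`, with the SAME `F` at every volume.
Frequency weights (`topWeight`, Fejér) and band/cutoff weights (`hubbardCutoffWeight`, functions of `ω² + ξ²`) multiply `F` and keep the form. [folklore] -/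
theorem shiftedFreeSymbol_eq_sampled (β μ θ : ℝ) (k : FreqMomentum V M) (σ : Fin 2) :
    shiftedFreeSymbol V M β μ θ (k, σ) = ((β * (V : ℝ) ^ 2 : ℝ) : ℂ) *
      (fun (ω : MatsubaraIdx M) (_ : Fin 2) (p : Fin 2 → ℝ) =>
        (Complex.I * ((matsubaraFreq β M ω + θ : ℝ) : ℂ) + ((-2 * ∑ i, Real.cos (p i) - μ : ℝ) : ℂ)) /
          (((matsubaraFreq β M ω + θ) ^ 2 + (-2 * ∑ i, Real.cos (p i) - μ) ^ 2 : ℝ) : ℂ)) k.1 σ (latticeMomentum V k.2) := by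
  simp only [shiftedFreeSymbol, nambuXi, torusBand]

end Symbols

end Summit.HubbardSuperconductivity.HubbardSuperconductivity.Theorems.TwoPointAssembly

end
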